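import Mathlib
import Literature.Computability.AlgebraicComplexity.NewtonPolygonTauProductBounds
import HarnessLib

/-!
# KPTT 2015, Appendix "the Newton polygon of `fg + 1`" — tools: Lemma 3 (vertex form) and the
# equal-support vertex lemma

P. Koiran, N. Portier, S. Tavenas, S. Thomassé, *A τ-conjecture for Newton polygons*, Found.
Comput. Math. 15 (2015) 185–197 (arXiv:1308.2286), Appendix (held text p0011). First of two files
(this one: the geometric tools; `NewtonPolygonTauProductPlusOne.lean`: Proposition 2 and
Theorem 7). All theorems, 0 definitions, 0 named facts.

* `KPTT.ProductPlusOne.not_six_extremePoints` — **Lemma 3** (p0011:L97–L99: "If `p`, `q`, `r` are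
  3 distinct nonzero points in the plane then the 6 points `p, q, r, 2p, 2q, 2r` are not convexly
  independent") in the VERTEX FORM the proof of Theorem 7 uses: three distinct nonzero points and
  their doubles are never all extreme points of one convex set `P ⊆ ℝ²`. Printed proof: "clear from
  a picture", two cases on the quadrangle `0pqr` (p0011:L101–L110). Ours (same content, organised
  along rays from the origin): if `0 ∈ P` then `p` is inside the segment `[0, 2p]`; if `0 ∉ P` then
  no two of the three directions are parallel (`parallel_false`: four collinear points
  `p, 2p, λp, 2λp` or `0 ∈ [p, q]`), and writing the third point in the basis of the other two,
  `q = a p + b r`: `a, b > 0` (or one negative coefficient, after relabelling) puts `q` or `2q`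
  strictly inside a segment of `P` (`middle_false`), while `a, b < 0` puts `0` in the triangle.
* `KPTT.extremePoints_newton_mul_subset_of_support_eq`, `KPTT.newtonVertexCount_mul_le_card_of_support_eq`
  — hypothesis (i) alone ("`f` and `g` have the same support"): the vertices of `Newt(fg)` are
  among the doubled support points `2p_j`, hence at most `t` of them ("Moreover,
  `Newt(fg) = Newt(f) + Newt(g) = conv(2p_0, …, 2p_{t-1})`", "`t` and not `2t` since `f` and `g` have
  the same support", p0011:L75–L84) — by the tree's Ostrowski lemma
  `KPTT.extremePoints_support_add_subset_support_mul`, the finite Krein–Milman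
  `Literature.Analysis.Convex.convexHull_extremePoints_convexHull` and the strict-top toolkit
  `KPTT.PlanarMinkowski.IsStrictTop.exists_eq_add` / `.unique` (`NewtonPolygonTauProductBounds.lean`),
  all used by name.

Conventions: supports embedded in `ℝ²` by `e ↦ (e₀, e₁)` as in the tree's `newtonVertexCount`;
polynomials over a commutative domain. Honest framing (val-lit): tools for a published partial
result on an OPEN question (KPTT §5; crux `ProductMinusPoints` of route NewtonFrames stays open);
nothing here bears on `VP ≠ VNP`, which is NOT proved.

## References

* P. Koiran, N. Portier, S. Tavenas, S. Thomassé, Found. Comput. Math. 15 (2015) 185–197,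
  arXiv:1308.2286: Appendix, Lemma 3 and the proof of Theorem 7 [KoiranPortierTavenasThomasse2015].
-/

noncomputable section

open Finset MvPolynomial
open scoped Pointwise

namespace Literature.Computability.AlgebraicComplexity

namespace KPTT

/-! ### Plane geometry: KPTT Appendix, Lemma 3 (vertex form) -/

namespace ProductPlusOne

variable {P : Set (Fin 2 → ℝ)}



/-- On a ray: if `a < b < c` and `a • u, c • u ∈ P` (`u ≠ 0`), then `b • u` is not an extreme point
of `P`. [folklore] -/
private theorem not_mem_extremePoints_of_lt_lt {u : Fin 2 → ℝ} (hu : u ≠ 0) {a b c : ℝ} (hab : a < b)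
    (hbc : b < c) (ha : a • u ∈ P) (hc : c • u ∈ P) : b • u ∉ P.extremePoints ℝ := by
  intro h
  have hseg : b • u ∈ openSegment ℝ (a • u) (c • u) := by
    rw [mem_openSegment_iff_div]
    refine ⟨c - b, b - a, by linarith, by linarith, ?_⟩
    have hca : (c - b) + (b - a) ≠ 0 := by linarith
    rw [smul_smul, smul_smul, ← add_smul]
    congr 1
    field_simp
    ring
  have := h.2 ha hc hseg
  have h0 : (a - b) • u = 0 := by rw [sub_smul, this, sub_self]
  rcases smul_eq_zero.1 h0 with h1 | h1
  · exact absurd h1 (by linarith)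
  · exact hu h1

/-- Two points on a common ray through the origin cannot both be vertices together with their
doubles (`0 ∉ P`). [folklore] -/
private theorem parallel_false (hP : Convex ℝ P) (h0 : (0 : Fin 2 → ℝ) ∉ P) {u v : Fin 2 → ℝ} (hu0 : u ≠ 0)
    (huv : u ≠ v) {l : ℝ} (hv : v = l • u)
    (hu : u ∈ P.extremePoints ℝ) (hv1 : v ∈ P.extremePoints ℝ)
    (hu2 : (2 : ℝ) • u ∈ P.extremePoints ℝ) (hv2 : (2 : ℝ) • v ∈ P.extremePoints ℝ) : False := by
  have huP : u ∈ P := hu.1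
  have hvP : v ∈ P := hv1.1
  have hu2P : (2 : ℝ) • u ∈ P := hu2.1
  have hv2P : (2 : ℝ) • v ∈ P := hv2.1
  have hl1 : l ≠ 1 := by rintro rfl; exact huv (by rw [hv, one_smul])
  have h2v : (2 : ℝ) • v = (2 * l) • u := by rw [hv, smul_smul]
  rcases lt_trichotomy l 0 with hl | hl | hl
  · -- `l < 0`: the origin lies on the segment `[v, u]`
    apply h0
    have hmem : (-l / (1 - l)) • u + (1 / (1 - l)) • v ∈ P :=
      hP huP hvP (by apply div_nonneg <;> linarith) (by apply div_nonneg <;> linarith)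
        (by field_simp; ring)
    have : (-l / (1 - l)) • u + (1 / (1 - l)) • v = 0 := by
      rw [hv, smul_smul, ← add_smul]
      have : -l / (1 - l) + 1 / (1 - l) * l = 0 := by field_simp; ring
      rw [this, zero_smul]
    rwa [this] at hmem
  · -- `l = 0`: `v = 0 ∈ P`
    exact h0 (by rwa [hv, hl, zero_smul] at hvP)
  · rcases lt_trichotomy l 1 with hl' | hl' | hl'
    · -- `0 < l < 1`: `u` lies strictly between `v = l u` and `2u`
      exact not_mem_extremePoints_of_lt_lt hu0 hl' one_lt_two (hv ▸ hvP) hu2P (by rwa [one_smul])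
    · exact hl1 hl'
    · rcases lt_trichotomy l 2 with hl'' | hl'' | hl''
      · -- `1 < l < 2`: `v` lies strictly between `u` and `2u`
        exact not_mem_extremePoints_of_lt_lt hu0 hl' hl'' (by rwa [one_smul]) hu2P (hv ▸ hv1)
      · -- `l = 2`: `2u = v` lies strictly between `u` and `2v = 4u`
        exact not_mem_extremePoints_of_lt_lt hu0 one_lt_two (by rw [hl'']; norm_num : (2:ℝ) < 2 * l)
          (by rwa [one_smul]) (h2v ▸ hv2P) hu2
      · -- `l > 2`: `v` lies strictly between `2u` and `2v`
        exact not_mem_extremePoints_of_lt_lt hu0 hl'' (by linarith : l < 2 * l) hu2P (h2v ▸ hv2P)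
          (hv ▸ hv1)

/-- A vertex direction strictly between two others is impossible: if `m = α u + β v` with
`α, β > 0`, `u ≠ v`, `u, v, 2u, 2v ∈ P` and `m, 2m` are extreme points of the convex set `P ∌ 0`,
contradiction. [folklore] -/
private theorem middle_false (hP : Convex ℝ P) (h0 : (0 : Fin 2 → ℝ) ∉ P) {u v m : Fin 2 → ℝ} (huv : u ≠ v)
    {α β : ℝ} (hα : 0 < α) (hβ : 0 < β) (hm : m = α • u + β • v)
    (huP : u ∈ P) (hvP : v ∈ P) (hu2P : (2 : ℝ) • u ∈ P) (hv2P : (2 : ℝ) • v ∈ P)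
    (hm1 : m ∈ P.extremePoints ℝ) (hm2 : (2 : ℝ) • m ∈ P.extremePoints ℝ) : False := by
  -- the point `w` of `[u, v]` on the ray of `m`, and `2w ∈ [2u, 2v]`
  set μ : ℝ := α + β with hμ
  have hμ0 : 0 < μ := add_pos hα hβ
  set w : Fin 2 → ℝ := (α / μ) • u + (β / μ) • v with hw
  have hwseg : w ∈ openSegment ℝ u v := by
    rw [mem_openSegment_iff_div]; exact ⟨α, β, hα, hβ, rfl⟩
  have hwP : w ∈ P := hP huP hvP (div_pos hα hμ0).le (div_pos hβ hμ0).le (by rw [hμ]; field_simp)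
  have h2w : (2 : ℝ) • w = (α / μ) • ((2 : ℝ) • u) + (β / μ) • ((2 : ℝ) • v) := by
    rw [hw, smul_add, smul_comm (2 : ℝ) (α / μ) u, smul_comm (2 : ℝ) (β / μ) v]
  have h2wseg : (2 : ℝ) • w ∈ openSegment ℝ ((2 : ℝ) • u) ((2 : ℝ) • v) := by
    rw [mem_openSegment_iff_div, h2w]; exact ⟨α, β, hα, hβ, rfl⟩
  have h2wP : (2 : ℝ) • w ∈ P := by
    rw [h2w]
    exact hP hu2P hv2P (div_pos hα hμ0).le (div_pos hβ hμ0).le (by rw [hμ]; field_simp)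
  have hw0 : w ≠ 0 := fun h => h0 (h ▸ hwP)
  have hmw : m = μ • w := by
    rw [hm, hw, smul_add, smul_smul, smul_smul, mul_div_cancel₀ _ hμ0.ne', mul_div_cancel₀ _ hμ0.ne']
  have h2mw : (2 : ℝ) • m = (2 * μ) • w := by rw [hmw, smul_smul]
  have hne2 : (2 : ℝ) • u ≠ (2 : ℝ) • v := fun h => huv (smul_right_injective _ two_ne_zero h)
  rcases lt_trichotomy μ (1 / 2) with h1 | h1 | h1
  · -- `μ < 1/2`: `2m` strictly between `m` and `w`
    exact not_mem_extremePoints_of_lt_lt hw0 (by linarith : μ < 2 * μ) (by linarith : 2 * μ < 1)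
      (hmw ▸ hm1.1) (by rwa [one_smul]) (h2mw ▸ hm2)
  · -- `μ = 1/2`: `2m = w ∈ (u, v)`
    have h2m : (2 : ℝ) • m = w := by rw [h2mw, h1]; norm_num
    have := (mem_extremePoints.1 hm2).2 u huP v hvP (h2m ▸ hwseg)
    exact huv (this.1.trans this.2.symm)
  · rcases lt_trichotomy μ 1 with h2 | h2 | h2
    · -- `1/2 < μ < 1`: `2m` strictly between `w` and `2w`
      exact not_mem_extremePoints_of_lt_lt hw0 (by linarith : (1 : ℝ) < 2 * μ)
        (by linarith : 2 * μ < 2) (by rwa [one_smul]) h2wP (h2mw ▸ hm2)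
    · -- `μ = 1`: `m = w ∈ (u, v)`
      have hm' : m = w := by rw [hmw, h2, one_smul]
      have := (mem_extremePoints.1 hm1).2 u huP v hvP (hm' ▸ hwseg)
      exact huv (this.1.trans this.2.symm)
    · rcases lt_trichotomy μ 2 with h3 | h3 | h3
      · -- `1 < μ < 2`: `m` strictly between `w` and `2w`
        exact not_mem_extremePoints_of_lt_lt hw0 h2 h3 (by rwa [one_smul]) h2wP (hmw ▸ hm1)
      · -- `μ = 2`: `m = 2w ∈ (2u, 2v)`
        have hm' : m = (2 : ℝ) • w := by rw [hmw, h3]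
        have := (mem_extremePoints.1 hm1).2 _ hu2P _ hv2P (hm' ▸ h2wseg)
        exact hne2 (this.1.trans this.2.symm)
      · -- `μ > 2`: `m` strictly between `2w` and `2m`
        exact not_mem_extremePoints_of_lt_lt hw0 h3 (by linarith : μ < 2 * μ) h2wP
          (h2mw ▸ hm2.1) (hmw ▸ hm1)

/-- If `det(u, v) = 0` and `u ≠ 0` then `v` is a multiple of `u`. [folklore] -/
private theorem exists_eq_smul_of_det_eq_zero {u v : Fin 2 → ℝ} (hu : u ≠ 0)
    (hdet : u 0 * v 1 - u 1 * v 0 = 0) : ∃ l : ℝ, v = l • u := by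
  by_cases h0 : u 0 = 0
  · have h1 : u 1 ≠ 0 := by
      intro h1; apply hu; ext i; fin_cases i <;> simp [h0, h1]
    refine ⟨v 1 / u 1, ?_⟩
    ext i; fin_cases i
    · simp only [Fin.zero_eta, Fin.isValue, Pi.smul_apply, smul_eq_mul]
      rw [h0] at hdet ⊢
      have : u 1 * v 0 = 0 := by linarith
      rcases mul_eq_zero.1 this with h | h
      · exact absurd h h1
      · rw [h, mul_zero]
    · simp only [Fin.mk_one, Fin.isValue, Pi.smul_apply, smul_eq_mul]
      field_simp
  · refine ⟨v 0 / u 0, ?_⟩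
    ext i; fin_cases i
    · simp only [Fin.zero_eta, Fin.isValue, Pi.smul_apply, smul_eq_mul]
      field_simp
    · simp only [Fin.mk_one, Fin.isValue, Pi.smul_apply, smul_eq_mul]
      field_simp
      linarith

/-- Cramer: if `det(x, z) ≠ 0` then `y = a x + b z` with `a = det(y,z)/det(x,z)`,
`b = det(x,y)/det(x,z)`. [folklore] -/
private theorem eq_smul_add_smul_of_det_ne_zero {x y z : Fin 2 → ℝ} (hdet : x 0 * z 1 - x 1 * z 0 ≠ 0) :
    y = ((y 0 * z 1 - y 1 * z 0) / (x 0 * z 1 - x 1 * z 0)) • x +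
      ((x 0 * y 1 - x 1 * y 0) / (x 0 * z 1 - x 1 * z 0)) • z := by
  ext i; fin_cases i
  · simp only [Fin.zero_eta, Fin.isValue, Pi.add_apply, Pi.smul_apply, smul_eq_mul]
    rw [div_mul_eq_mul_div, div_mul_eq_mul_div, ← add_div, eq_div_iff hdet]
    ring
  · simp only [Fin.mk_one, Fin.isValue, Pi.add_apply, Pi.smul_apply, smul_eq_mul]
    rw [div_mul_eq_mul_div, div_mul_eq_mul_div, ← add_div, eq_div_iff hdet]
    ring

/-- If `y = a x + b z` with `a, b < 0` and `x, y, z ∈ P` convex, then `0 ∈ P`. [folklore] -/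
private theorem zero_mem_of_neg_neg (hP : Convex ℝ P) {x y z : Fin 2 → ℝ} (hx : x ∈ P) (hy : y ∈ P)
    (hz : z ∈ P) {a b : ℝ} (ha : a < 0) (hb : b < 0) (h : y = a • x + b • z) :
    (0 : Fin 2 → ℝ) ∈ P := by
  have hs : 0 < -a - b := by linarith
  have hs1 : 0 < 1 - a - b := by linarith
  -- `t ∈ [x, z]`, then `0 ∈ [y, t]`
  have ht : (-a / (-a - b)) • x + (-b / (-a - b)) • z ∈ P :=
    hP hx hz (div_pos (by linarith) hs).le (div_pos (by linarith) hs).le (by field_simp; ring)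
  have key : (1 / (1 - a - b)) • y +
      ((-a - b) / (1 - a - b)) • ((-a / (-a - b)) • x + (-b / (-a - b)) • z) = 0 := by
    rw [h]
    ext i
    simp only [Pi.add_apply, Pi.smul_apply, smul_eq_mul, Pi.zero_apply]
    field_simp
    ring
  have := hP hy ht (div_pos one_pos hs1).le (div_pos hs hs1).le (by field_simp; ring)
  rwa [key] at this

/-- **KPTT 2015, Appendix, Lemma 3 (vertex form).** Printed: "If `p`, `q`, `r` are 3 distinct
nonzero points in the plane then the 6 points `p, q, r, 2p, 2q, 2r` are not convexly independent."
Here in the form the proof of Theorem 7 uses: three distinct nonzero points `x, y, z` of the plane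
and their doubles `2x, 2y, 2z` are never all extreme points of one convex set `P`. (Printed proof:
"clear from a picture", two cases on the quadrangle `0pqr`; ours: `0 ∈ P` puts `x` inside `[0, 2x]`;
for `0 ∉ P` no two directions are parallel and the middle one is impossible, `parallel_false`,
`middle_false`, or `0` lies in the triangle.)
[cite: KoiranPortierTavenasThomasse2015, Appendix, Lemma 3 (held text p0011:L97–L110)] -/
theorem not_six_extremePoints (hP : Convex ℝ P) {x y z : Fin 2 → ℝ}
    (hx0 : x ≠ 0) (hz0 : z ≠ 0) (hxy : x ≠ y) (hxz : x ≠ z) (hyz : y ≠ z)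
    (hx : x ∈ P.extremePoints ℝ) (hy : y ∈ P.extremePoints ℝ) (hz : z ∈ P.extremePoints ℝ)
    (hx2 : (2 : ℝ) • x ∈ P.extremePoints ℝ) (hy2 : (2 : ℝ) • y ∈ P.extremePoints ℝ)
    (hz2 : (2 : ℝ) • z ∈ P.extremePoints ℝ) : False := by
  by_cases h0 : (0 : Fin 2 → ℝ) ∈ P
  · -- `x` lies strictly between `0 = 0 • x` and `2 • x`
    exact not_mem_extremePoints_of_lt_lt hx0 zero_lt_one one_lt_two (by rwa [zero_smul]) hx2.1
      (by rwa [one_smul])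
  -- no two of the three directions are parallel
  have hpar : ∀ {u v : Fin 2 → ℝ}, u ≠ 0 → u ≠ v → u ∈ P.extremePoints ℝ → v ∈ P.extremePoints ℝ →
      (2 : ℝ) • u ∈ P.extremePoints ℝ → (2 : ℝ) • v ∈ P.extremePoints ℝ →
      u 0 * v 1 - u 1 * v 0 ≠ 0 := by
    intro u v hu0 huv hu hv hu2 hv2 hdet
    obtain ⟨l, hl⟩ := exists_eq_smul_of_det_eq_zero hu0 hdet
    exact parallel_false hP h0 hu0 huv hl hu hv hu2 hv2
  have hdxz := hpar hx0 hxz hx hz hx2 hz2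
  have hdxy := hpar hx0 hxy hx hy hx2 hy2
  have hdzy := hpar hz0 (Ne.symm hyz) hz hy hz2 hy2
  -- `y = a x + b z`
  set a : ℝ := (y 0 * z 1 - y 1 * z 0) / (x 0 * z 1 - x 1 * z 0) with ha
  set b : ℝ := (x 0 * y 1 - x 1 * y 0) / (x 0 * z 1 - x 1 * z 0) with hb
  have hyab : y = a • x + b • z := eq_smul_add_smul_of_det_ne_zero hdxz
  have ha0 : a ≠ 0 := by
    intro ha0
    rw [ha0, zero_smul, zero_add] at hyab
    apply hdzy
    rw [hyab]; simp only [Pi.smul_apply, smul_eq_mul]; ring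
  have hb0 : b ≠ 0 := by
    intro hb0
    rw [hb0, zero_smul, add_zero] at hyab
    apply hdxy
    rw [hyab]; simp only [Pi.smul_apply, smul_eq_mul]; ring
  rcases lt_or_gt_of_ne ha0 with ha' | ha'
  · rcases lt_or_gt_of_ne hb0 with hb' | hb'
    · -- `a, b < 0`: the origin is inside the triangle
      exact h0 (zero_mem_of_neg_neg hP hx.1 hy.1 hz.1 ha' hb' hyab)
    · -- `a < 0 < b`: `z = (1/b) y + (-a/b) x` lies strictly between `y` and `x`
      have hz' : z = (1 / b) • y + (-a / b) • x := by
        rw [hyab]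
        ext i
        simp only [Pi.add_apply, Pi.smul_apply, smul_eq_mul]
        field_simp
        ring
      exact middle_false hP h0 (Ne.symm hxy) (div_pos one_pos hb') (div_pos (by linarith) hb') hz'
        hy.1 hx.1 hy2.1 hx2.1 hz hz2
  · rcases lt_or_gt_of_ne hb0 with hb' | hb'
    · -- `b < 0 < a`: `x = (1/a) y + (-b/a) z` lies strictly between `y` and `z`
      have hx' : x = (1 / a) • y + (-b / a) • z := by
        rw [hyab]
        ext i
        simp only [Pi.add_apply, Pi.smul_apply, smul_eq_mul]
        field_simp
        ring
      exact middle_false hP h0 hyz (div_pos one_pos ha') (div_pos (by linarith) ha') hx'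
        hy.1 hz.1 hy2.1 hz2.1 hx hx2
    · -- `a, b > 0`: `y` lies strictly between `x` and `z`
      exact middle_false hP h0 hxz ha' hb' hyab hx.1 hz.1 hx2.1 hz2.1 hy hy2



end ProductPlusOne

/-! ### Polynomials: the vertices of `Newt(fg)` under equal supports -/

section Polys

open ProductPlusOne PlanarMinkowski

variable {k : Type*} [CommRing k] [IsDomain k]

/-- The real embedding of exponent vectors is additive. [folklore] -/
private theorem natEmb_add' (e e' : Fin 2 →₀ ℕ) :
    (fun i : Fin 2 => (((e + e') i : ℕ) : ℝ)) =
      (fun i : Fin 2 => ((e i : ℕ) : ℝ)) + fun i : Fin 2 => ((e' i : ℕ) : ℝ) := by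
  ext i; simp

/-- **Equal supports: the vertices of `Newt(fg)` are doubled monomials of `f`** ("Moreover,
`Newt(fg) = Newt(f) + Newt(g) = conv(2p_0, …, 2p_{t-1})`", proof of Theorem 7): if
`Mon(f) = Mon(g)` then every vertex of `Newt(fg)` is `2p` for some `p ∈ Mon(f)` (Ostrowski: a vertex
of a Minkowski sum `A + A` is exposed by a weight whose strict tops in the two summands coincide).
[cite: KoiranPortierTavenasThomasse2015, Appendix, proof of Thm. 7 (held text p0011:L75–L80)] -/
theorem extremePoints_newton_mul_subset_of_support_eq (f g : MvPolynomial (Fin 2) k)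
    (hfg : f.support = g.support) :
    (convexHull ℝ ((fun e : Fin 2 →₀ ℕ => fun i : Fin 2 => ((e i : ℕ) : ℝ)) ''
        ((f * g).support : Set (Fin 2 →₀ ℕ)))).extremePoints ℝ ⊆
      (fun e : Fin 2 →₀ ℕ => fun i : Fin 2 => (((e + e) i : ℕ) : ℝ)) '' (f.support : Set (Fin 2 →₀ ℕ)) := by
  classical
  intro v hv
  set emb : (Fin 2 →₀ ℕ) → (Fin 2 → ℝ) := fun e i => ((e i : ℕ) : ℝ) with hemb
  by_cases hf : f = 0
  · exfalso
    rw [hf, zero_mul, support_zero, Finset.coe_empty, Set.image_empty, convexHull_empty,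
      extremePoints_empty] at hv
    exact absurd hv (by simp)
  have hg : g ≠ 0 := by
    intro hg; apply hf
    exact support_eq_empty.1 (by rw [hfg, hg, support_zero])
  set A := f.support.image emb with hAdef
  set B := g.support.image emb with hBdef
  have hAB : A = B := by rw [hAdef, hBdef, hfg]
  have hA : A.Nonempty := (support_nonempty.2 hf).image _
  -- `conv(supp fg) = conv(A + B)` (Ostrowski)
  have hF : emb '' ((f * g).support : Set (Fin 2 →₀ ℕ)) ⊆ ((A + B : Finset (Fin 2 → ℝ)) : Set (Fin 2 → ℝ)) := by
    rintro _ ⟨e, he, rfl⟩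
    have he' := MvPolynomial.support_mul f g (Finset.mem_coe.1 he)
    obtain ⟨α, hα, β, hβ, rfl⟩ := Finset.mem_add.1 he'
    rw [Finset.mem_coe, show emb (α + β) = emb α + emb β from natEmb_add' α β]
    exact Finset.add_mem_add (Finset.mem_image_of_mem _ hα) (Finset.mem_image_of_mem _ hβ)
  have hE := extremePoints_support_add_subset_support_mul f g
  have hconv : convexHull ℝ (emb '' ((f * g).support : Set (Fin 2 →₀ ℕ))) =
      convexHull ℝ ((A + B : Finset (Fin 2 → ℝ)) : Set (Fin 2 → ℝ)) := by
    refine (convexHull_mono hF).antisymm ?_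
    rw [← Literature.Analysis.Convex.convexHull_extremePoints_convexHull (𝕜 := ℝ)
      ((A + B).finite_toSet)]
    exact convexHull_mono hE
  rw [hconv] at hv
  obtain ⟨w, hw⟩ := exists_isStrictTop_of_mem_extremePoints hv
  obtain ⟨a, b, ha, hb, hab⟩ := hw.exists_eq_add hA (hAB ▸ hA)
  have heq : a = b := ha.unique (hAB ▸ hb)
  obtain ⟨p, hp, rfl⟩ := Finset.mem_image.1 ha.mem
  refine ⟨p, Finset.mem_coe.2 hp, ?_⟩
  rw [hab, ← heq, show emb p = fun i : Fin 2 => ((p i : ℕ) : ℝ) from rfl]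
  exact natEmb_add' p p

/-- With equal supports, `Newt(fg)` has at most `t = |Mon(f)|` vertices ("`t` and not `2t` since
`f` and `g` have the same support", proof of Theorem 7).
[cite: KoiranPortierTavenasThomasse2015, Appendix, proof of Thm. 7 (held text p0011:L82–L84)] -/
theorem newtonVertexCount_mul_le_card_of_support_eq (f g : MvPolynomial (Fin 2) k)
    (hfg : f.support = g.support) : newtonVertexCount (f * g) ≤ f.support.card := by
  have h := extremePoints_newton_mul_subset_of_support_eq f g hfg
  unfold newtonVertexCount
  calc (Set.extremePoints ℝ (convexHull ℝ ((fun e : Fin 2 →₀ ℕ => fun i : Fin 2 => ((e i : ℕ) : ℝ)) ''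
          ((f * g).support : Set (Fin 2 →₀ ℕ))))).ncard
      ≤ ((fun e : Fin 2 →₀ ℕ => fun i : Fin 2 => (((e + e) i : ℕ) : ℝ)) ''
          (f.support : Set (Fin 2 →₀ ℕ))).ncard := Set.ncard_le_ncard h (f.support.finite_toSet.image _)
    _ ≤ (f.support : Set (Fin 2 →₀ ℕ)).ncard := Set.ncard_image_le f.support.finite_toSet
    _ = f.support.card := Set.ncard_coe_finset _

end Polys

end KPTT

end Literature.Computability.AlgebraicComplexity
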